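import Literature.NumberTheory.Automorphic.UnitaryGroupRayJacquetCriterionAnyRank   -- ★ p843879 (this seat): `AnyRank.isSupercuspidal_of_coinvariants_subsingleton_of_cartan_diagonal_two`
import Literature.NumberTheory.Automorphic.U3JacquetVanishingSupercuspidal          -- ★ transport helpers: `ParabolicTriple.subsingleton_coinvariants_of_comp_of_forall`, `coe_localNonsplitEquiv_apply`, `galAdicCompletionMap` facts
import Literature.NumberTheory.Automorphic.UnitaryGroupBorelPair                     -- ★ `glDiagonal_mem_unitaryGroupOfForm_antidiagonal_iff`
import HarnessLib

/-!
# Harish-Chandra's criterion ⇐ for `U(Φ₂)(L⁺_v)` at a non-split place, MODULO the Cartan decomposition of `U(σ, Φ₂)(K)`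

THEOREMS ONLY (no `def`, no `instance`, no notation, no named fact, no `sorry`; axioms ⊆ {propext, Classical.choice, Quot.sound}).
Cell `pub/hodgecm-mathlib`, crux `H413` (`stmt-HodgeConjecture-24833`), line «CMCharIdentityTest», joint (N-H-ii′): after ★
`F0P3bU2PrincipalSeriesHCOfJacquetCriterion.hHC_of_jacquetVanishing_supercuspidal_two` the joint hinges on
**(HC₂)** «at a non-split `v`, an irreducible smooth representation of `U(Φ₂)(L⁺_v)` with zero Jacquet module along `B₂` is supercuspidal».
This file is the `N = 2` twin of ★ `Rogawski1990.u3_isSupercuspidal_iff_jacquet_eq_zero_mpr` (`U3JacquetVanishingSupercuspidal`): it proves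
(HC₂) from the ONE structural input still missing from the tree,
**(Cartan₂)** «`U(σ, Φ₂)(K) = ⋃ₙ K₀ · d(ϖ, (σϖ)⁻¹)ⁿ · K₀ · Z(U)` for a discretely valued field `K`, an isometric involution `σ`, a uniformiser `ϖ`»
(the `N = 2` twin of ★ `exists_cartan_of_involution`, `UnitaryGroupRankOneCartanAnyInvolution`), stated below as the hypothesis `hCartan₂`
in exactly the currency of that file.
* §1 `exists_coe_eq_diagonal_uniformizer_two` — the ray generator `d(ϖ, (σϖ)⁻¹) ∈ U(σ, Φ₂)(K)` (★ `glDiagonal_mem_unitaryGroupOfForm_antidiagonal_iff`);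
  `localNonsplitEquiv_mem_unipotentU_of_mem` — the one-place model ★ `localNonsplitEquiv` maps the unipotent radical of ★ `cmBorelTriple L N v`
  into ★ `unipotentU` (any `N`; the `N = 3` instance is ★ `localNonsplitEquiv_mem_unipotentU`).
* §2 **`jacquetVanishing_isSupercuspidal_two_of_cartan (hCartan₂)`** : (HC₂) VERBATIM (the binder `hHC₂` of ★
  `hHC_of_jacquetVanishing_supercuspidal_two`): transport `r` to `U(σ_w, Φ₂)(L_w)` (★ `localNonsplitEquiv`, ★ `IrrClass.isSupercuspidal_comap_iff`,
  ★ `ParabolicTriple.subsingleton_coinvariants_of_comp_of_forall`), take a uniformiser `ϖ` of `L_w`, the ray `a = d(ϖ, (σ_w ϖ)⁻¹)` (§1),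
  `hCartan₂`, and ★ `AnyRank.isSupercuspidal_of_coinvariants_subsingleton_of_cartan_diagonal_two`.
HONEST SCOPE: conditional on `hCartan₂` only; HC_CM is proved only modulo the printed citations (hLiu418, h413) until rung 0 closes.

## References
* [Casselman1995] W. Casselman, *Introduction to the theory of admissible representations of `p`-adic reductive groups* (1995), Thm. 5.3.1.
* [BernsteinZelevinsky1976] I. N. Bernstein, A. V. Zelevinsky, Russian Math. Surveys 31:3 (1976), §3.18–3.21, Thm. 3.21.
* [BruhatTits1972] F. Bruhat, J. Tits, *Groupes réductifs sur un corps local I*, Publ. Math. IHÉS 41 (1972), (4.4.3).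
* [Rogawski1990] J. D. Rogawski, Ann. of Math. Stud. 123 (1990), §1.10 p. 9, §12.1 pp. 171–172.
* [PlatonovRapinchuk1994] V. Platonov, A. Rapinchuk, *Algebraic Groups and Number Theory* (1994), §5.1.
-/

set_option autoImplicit false

open scoped MatrixGroups Pointwise Topology WithZero
open ValuativeRel Matrix

namespace Literature.NumberTheory.Automorphic

namespace UnitaryGroup

/-! ## §1 The ray generator of `U(σ, Φ₂)(K)` and the unipotent radical under the one-place model -/

section Ray

variable {K : Type*} [Field K] (σ : K →+* K) {J : Matrix (Fin 2) (Fin 2) K} (hJ : J = (StdForm.antidiagonal 2).over K) {ϖ : K}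

include hJ in
/-- **The torus ray generator of `U(σ, Φ₂)(K)` exists**: for `ϖ ≠ 0` there is `a ∈ U(σ, Φ₂)` with matrix `d(ϖ, (σϖ)⁻¹)` (`σ` an involution;
`ϖ` need not be `σ`-fixed). [cite: Rogawski1990, §1.10 p. 9] -/
theorem exists_coe_eq_diagonal_uniformizer_two (hσσ : ∀ x, σ (σ x) = x) (hϖ0 : ϖ ≠ 0) :
    ∃ a : ↥(unitaryGroupOfForm σ J), ((a : GL (Fin 2) K) : Matrix (Fin 2) (Fin 2) K) = Matrix.diagonal ![ϖ, (σ ϖ)⁻¹] := by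
  have hσϖ : σ ϖ ≠ 0 := (map_ne_zero σ).2 hϖ0
  obtain ⟨d, hd0, hd1⟩ : ∃ d : Fin 2 → Kˣ, (d 0 : K) = ϖ ∧ (d 1 : K) = (σ ϖ)⁻¹ :=
    ⟨![Units.mk0 ϖ hϖ0, (Units.mk0 (σ ϖ) hσϖ)⁻¹], rfl, by simp⟩
  have hdU : glDiagonal 2 K d ∈ unitaryGroupOfForm σ J := by
    rw [hJ, glDiagonal_mem_unitaryGroupOfForm_antidiagonal_iff]
    intro i
    fin_cases i
    · show σ ((d (Fin.rev 0) : Kˣ) : K) * ((d 0 : Kˣ) : K) = 1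
      rw [show Fin.rev (0 : Fin 2) = 1 from rfl, hd1, hd0, map_inv₀, hσσ, inv_mul_cancel₀ hϖ0]
    · show σ ((d (Fin.rev 1) : Kˣ) : K) * ((d 1 : Kˣ) : K) = 1
      rw [show Fin.rev (1 : Fin 2) = 0 from rfl, hd0, hd1, mul_inv_cancel₀ hσϖ]
  refine ⟨⟨glDiagonal 2 K d, hdU⟩, ?_⟩
  rw [Subgroup.coe_mk, coe_glDiagonal]
  congr 1
  funext i
  fin_cases i
  · exact hd0
  · exact hd1

end Ray

section CM

open _root_.NumberField _root_.IsDedekindDomain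

variable (L : Type) [Field L] [NumberField L] [IsCMField L]

/-- The one-place model ★ `localNonsplitEquiv` sends the unipotent radical `N` of the Borel of `U(Φ_N)(L⁺_v)` (★ `cmBorelTriple L N v`) into
the upper unitriangular subgroup ★ `unipotentU` of `U(σ_w, Φ_N)(L_w)` (entries are evaluated at `w`); any `N` (the `N = 3` instance is ★
`localNonsplitEquiv_mem_unipotentU`). [cite: PlatonovRapinchuk1994, §5.1] [cite: Rogawski1990, §1.10 p. 9] -/
theorem localNonsplitEquiv_mem_unipotentU_of_mem {N : ℕ} (v : HeightOneSpectrum (𝓞 ↥(maximalRealSubfield L)))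
    (w : PlacesOver L v) (hw : IsCMField.complexConj L • w.1 = w.1)
    {n : «local» L (IsCMField.complexConj L) N (Matrix.of fun i j : Fin N => if i.val + j.val + 1 = N then (1 : L) else 0) v}
    (hn : n ∈ (cmBorelTriple L N v).N) :
    localNonsplitEquiv (IsCMField.complexConj L) (Matrix.of fun i j : Fin N => if i.val + j.val + 1 = N then (1 : L) else 0)
        (IsCMField.complexConj_ne_one L) w hw n ∈
      unipotentU (galAdicCompletionMap (L := L) (IsCMField.complexConj L) hw)
        (placeForm (Matrix.of fun i j : Fin N => if i.val + j.val + 1 = N then (1 : L) else 0) w.1) := by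
  have hn' : ((n : «local» L (IsCMField.complexConj L) N (Matrix.of fun i j : Fin N => if i.val + j.val + 1 = N then (1 : L) else 0) v) :
      GL (Fin N) (LocalRing L v)) ∈ upperUnitriangular (Fin N) (LocalRing L v) := hn
  obtain ⟨htri, hdiag⟩ := (mem_upperUnitriangular_iff _).1 hn'
  rw [mem_unipotentU_iff]
  refine ⟨fun i j hij => ?_, fun i => ?_⟩
  · have h := congr_fun (congr_fun (coe_localNonsplitEquiv_apply L
      (Matrix.of fun i j : Fin N => if i.val + j.val + 1 = N then (1 : L) else 0) v w hw n) i) j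
    rw [h, Matrix.map_apply, htri hij]
    exact map_zero _
  · have h := congr_fun (congr_fun (coe_localNonsplitEquiv_apply L
      (Matrix.of fun i j : Fin N => if i.val + j.val + 1 = N then (1 : L) else 0) v w hw n) i) i
    rw [h, Matrix.map_apply, hdiag i]
    exact map_one _

/-! ## §2 (HC₂) from (Cartan₂) -/

/-- **HARISH-CHANDRA'S CRITERION ⇐ FOR `U(Φ₂)(L⁺_v)` AT EVERY NON-SPLIT PLACE, MODULO THE CARTAN DECOMPOSITION OF `U(σ, Φ₂)(K)`.**
Assume (Cartan₂) `hCartan₂`: for every discretely valued field `K` (`Valued K ℤᵐ⁰`, compatible `ValuativeRel`), every involution `σ` of `K`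
preserving the valuation, every uniformiser `ϖ` (`|ϖ| = exp(-1)`) and the element `a ∈ U(σ, Φ₂)(K)` with matrix `d(ϖ, (σϖ)⁻¹)`, one has
`U = ⋃ₙ K₀ aⁿ K₀ Z(U)` (`K₀ = U ∩ GL₂(𝒪)`).  Then for a CM field `L`, a finite place `v` of `L⁺` NON-SPLIT in `L`, and an irreducible
smooth representation `r` of `U(Φ₂)(L⁺_v)` with ZERO Jacquet module along `B₂` (★ `cmBorelTriple L 2 v`), the class of `r` is supercuspidal
— the binder `hHC₂` of ★ `F0P3bU2PrincipalSeriesHCOfJacquetCriterion.hHC_of_jacquetVanishing_supercuspidal_two` VERBATIM.  Proof: the `N = 2`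
twin of ★ `u3_isSupercuspidal_iff_jacquet_eq_zero_mpr` — one-place model (★ `localNonsplitEquiv`), uniformiser of `L_w`, ray (§1), `hCartan₂`,
★ `AnyRank.isSupercuspidal_of_coinvariants_subsingleton_of_cartan_diagonal_two`, transport back (★ `IrrClass.isSupercuspidal_comap_iff`).
[cite: Casselman1995, Thm. 5.3.1] [cite: BernsteinZelevinsky1976, Thm. 3.21] [cite: BruhatTits1972, (4.4.3)] [cite: Rogawski1990, §12.1 pp. 171–172] -/
theorem jacquetVanishing_isSupercuspidal_two_of_cartan
    (hCartan₂ : ∀ (K : Type) [Field K] [Valued K ℤᵐ⁰] [ValuativeRel K] [(Valued.v : Valuation K ℤᵐ⁰).Compatible]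
      (σ : K →+* K) (J : Matrix (Fin 2) (Fin 2) K), J = (StdForm.antidiagonal 2).over K →
      (∀ x, σ (σ x) = x) → (∀ x, Valued.v (σ x) = Valued.v x) →
      ∀ (ϖ : K), Valued.v ϖ = WithZero.exp (-1 : ℤ) →
      ∀ (a : ↥(unitaryGroupOfForm σ J)), ((a : GL (Fin 2) K) : Matrix (Fin 2) (Fin 2) K) = Matrix.diagonal ![ϖ, (σ ϖ)⁻¹] →
      ∀ g : ↥(unitaryGroupOfForm σ J), ∃ k₁ ∈ (glInt 2 K).comap (unitaryGroupOfForm σ J).subtype,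
        ∃ k₂ ∈ (glInt 2 K).comap (unitaryGroupOfForm σ J).subtype, ∃ n : ℕ, ∃ z ∈ Subgroup.center ↥(unitaryGroupOfForm σ J),
          g = k₁ * a ^ n * k₂ * z) :
    ∀ (L : Type) [Field L] [NumberField L] [IsCMField L] (v : HeightOneSpectrum (𝓞 ↥(maximalRealSubfield L))),
      (∀ w : PlacesOver L v, IsCMField.complexConj L • w.1 = w.1) →
      ∀ r : SmoothIrrep ↥(unitaryGroupOfForm (conjLocal L (IsCMField.complexConj L) v) (cmLocalForm L 2 v)),
        Subsingleton ((cmBorelTriple L 2 v).restrict r.ρ).Coinvariants → (IrrClass.mk r).IsSupercuspidal := by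
  intro L _ _ _ v hns r h
  classical
  obtain ⟨w⟩ := (inferInstance : Nonempty (PlacesOver L v))
  have hw := hns w
  -- the one-place model and its data
  obtain ⟨e, he⟩ : ∃ e : ↥(unitaryGroupOfForm (conjLocal L (IsCMField.complexConj L) v) (cmLocalForm L 2 v)) ≃ₜ*
      ↥(unitaryGroupOfForm (galAdicCompletionMap (L := L) (IsCMField.complexConj L) hw)
        (placeForm (Matrix.of fun i j : Fin 2 => if i.val + j.val + 1 = 2 then (1 : L) else 0) w.1)),
      e = localNonsplitEquiv (IsCMField.complexConj L) (Matrix.of fun i j : Fin 2 => if i.val + j.val + 1 = 2 then (1 : L) else 0)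
        (IsCMField.complexConj_ne_one L) w hw := ⟨_, rfl⟩
  have hJw : placeForm (Matrix.of fun i j : Fin 2 => if i.val + j.val + 1 = 2 then (1 : L) else 0) w.1 =
      (StdForm.antidiagonal 2).over (w.1.adicCompletion L) := by
    rw [placeForm, antidiagOne_eq_over, StdForm.over_map]
  have hσσ : ∀ x, (galAdicCompletionMap (L := L) (IsCMField.complexConj L) hw) ((galAdicCompletionMap (L := L) (IsCMField.complexConj L) hw) x) = x :=
    galAdicCompletionMap_galAdicCompletionMap_of_smul_eq (IsCMField.complexConj L) w (IsCMField.complexConj_ne_one L) hw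
  have hσv : ∀ x, Valued.v ((galAdicCompletionMap (L := L) (IsCMField.complexConj L) hw) x) = Valued.v x :=
    fun x => valued_galAdicCompletionMap (L := L) (IsCMField.complexConj L) hw x
  have hσv' : ∀ x, valuation (w.1.adicCompletion L) ((galAdicCompletionMap (L := L) (IsCMField.complexConj L) hw) x) =
      valuation (w.1.adicCompletion L) x :=
    fun x => (v_eq_iff_valuation_eq _ _).1 (hσv x)
  -- a uniformiser of `L_w` and the twisted ray
  obtain ⟨π, hπ⟩ := IsDedekindDomain.HeightOneSpectrum.valuation_exists_uniformizer L w.1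
  have hϖ : Valued.v ((π : L) : w.1.adicCompletion L) = WithZero.exp (-1 : ℤ) := by
    rw [IsDedekindDomain.HeightOneSpectrum.valuedAdicCompletion_eq_valuation']; exact hπ
  have hϖ0 : ((π : L) : w.1.adicCompletion L) ≠ 0 := fun h0 => by
    rw [h0, map_zero] at hϖ
    exact WithZero.zero_ne_coe hϖ
  have hϖ1 : valuation (w.1.adicCompletion L) ((π : L) : w.1.adicCompletion L) < 1 := by
    refine (v_lt_one_iff_valuation_lt_one _).1 ?_
    rw [hϖ, ← WithZero.exp_zero]
    exact WithZero.exp_lt_exp.2 (by norm_num)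
  obtain ⟨a, ha⟩ := exists_coe_eq_diagonal_uniformizer_two (galAdicCompletionMap (L := L) (IsCMField.complexConj L) hw) hJw hσσ hϖ0
  have hcartan := hCartan₂ (w.1.adicCompletion L) (galAdicCompletionMap (L := L) (IsCMField.complexConj L) hw) _ hJw hσσ hσv _ hϖ a ha
  -- transport: the vanishing goes to the model, supercuspidality comes back
  have hsub : Subsingleton ((borelTriple (galAdicCompletionMap (L := L) (IsCMField.complexConj L) hw)
      (placeForm (Matrix.of fun i j : Fin 2 => if i.val + j.val + 1 = 2 then (1 : L) else 0) w.1) hJw).restrict (r.comap e.symm).ρ).Coinvariants :=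
    ParabolicTriple.subsingleton_coinvariants_of_comp_of_forall
      (borelTriple (galAdicCompletionMap (L := L) (IsCMField.complexConj L) hw)
        (placeForm (Matrix.of fun i j : Fin 2 => if i.val + j.val + 1 = 2 then (1 : L) else 0) w.1) hJw)
      (cmBorelTriple L 2 v)
      (e : ↥(unitaryGroupOfForm (conjLocal L (IsCMField.complexConj L) v) (cmLocalForm L 2 v)) →*
        ↥(unitaryGroupOfForm (galAdicCompletionMap (L := L) (IsCMField.complexConj L) hw)
          (placeForm (Matrix.of fun i j : Fin 2 => if i.val + j.val + 1 = 2 then (1 : L) else 0) w.1)))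
      (r.comap e.symm).ρ r.ρ (fun g => by
        rw [SmoothIrrep.comap_ρ_apply]; exact congrArg r.ρ (e.symm_apply_apply g).symm)
      (fun n hn => by rw [he]; exact localNonsplitEquiv_mem_unipotentU_of_mem L v w hw hn) h
  have main := AnyRank.isSupercuspidal_of_coinvariants_subsingleton_of_cartan_diagonal_two
    (galAdicCompletionMap (L := L) (IsCMField.complexConj L) hw) hJw
    (continuous_galAdicCompletionMap (L := L) (IsCMField.complexConj L) hw) hσv' hϖ0 hϖ1 a ha hcartan (r.comap e.symm).ρ
    (r.comap e.symm).isSmooth hsub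
  have h1 : (IrrClass.comap e.symm (IrrClass.mk r)).IsSupercuspidal := by
    rw [IrrClass.comap_mk]
    exact (IrrClass.isSupercuspidal_mk _).2 main
  exact (IrrClass.isSupercuspidal_comap_iff e.symm (IrrClass.mk r)).1 h1

end CM

end UnitaryGroup

end Literature.NumberTheory.Automorphic
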